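import Literature.MathematicalPhysics.QuantumFieldTheory.Balaban1983to89.T4AveragingDeficitWallBoundary
import HarnessLib

/-!
# T⁴ programme, node NE3 — kinematic refinement lemma, row R0 (glue), part 1b: PERIODIC CHOICE
# (a bond-wise existence statement with periodic data has a periodic witness field)

NE3 formalisation swarm `b2b-balaban-t4-ne3-formalise-*`, LEAF PROVER 09 (unit `b2b-balaban-t4-ne3-formalise-leaf-09`),
crew register `t4/formal/NE3/LEAVES.md` row **R0** of the cell `pub-balaban` (owner skeleton
`t4/b2b-balaban-t4-ne3-p1/SKELETON-NE3-P1.md` v1.1 §3 rows R0/R2).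

## Why this file exists

Leaf R2a of the kinematic lemma (`Support/ChainEndContraction.exists_chainEnd_fixedPoint`, owner) produces, for EACH
coarse bond `(z, κ)` separately, a unitary chain-end correction `c` solving one fixed-point equation whose data (the
off-line loop variables, the chain product, the target `U(z, κ)`) are periodic in `z` when the fine field `W` and the
target `U` are torus configurations.  The glue R0 needs ONE correction FIELD `c : ℤ^d → (directions) → units` that is
PERIODIC (so that the corrected field `W·c` is again a torus configuration, `MinimalActionRefine.RegularSup.periodic`).
Bond-wise existence gives a field by choice; periodicity is obtained by choosing on the wrapped representative
`z mod P` — elementary, but it must be kernel-checked once.  This file: §1 single-direction periodicity of ANY function on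
`ℤ^d` (any codomain) extends to all period vectors (the tree's `T4AveragingDeficitWallBoundary.periodic_vec` is the
real-valued case); §2 the wrap map `x ↦ x mod P` (an explicit lambda) and `x = (x mod P) + P·(x div P)`; §3 **`exists_periodic_choice`**: if
`Q x μ a` is `P`-periodic in `x` and `∀ x μ, ∃ a, Q x μ a`, then there is a `P`-periodic `c` with `∀ x μ, Q x μ (c x μ)`;
§4 the configuration reading `exists_isPeriodicCfg_choice` (conclusion `IsPeriodicCfg c P` BY NAME).

HONEST FRAMING.  Set-theoretic bookkeeping on `ℤ^d`; [folklore]; no printed sentence is a hypothesis; no `def … : Prop`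
fact and no new definition (the wrap map is the explicit lambda `fun κ => x κ % P`); no `sorry`; axioms ⊆ {propext, Classical.choice, Quot.sound}.  NE3 is NOT
proved by this file; the cell's conditionals (`BetaPertH`, (B), G-an2-4) occur nowhere here; finite T⁴ rung (B)+1 — NOT
infinite volume, NOT a mass gap, NOT the Clay problem.  HONEST DEPENDENCY (cell page 1): continuum YM on T⁴ ⇐ BetaPertH ∧
nine spine estimates (0/9 proved); BetaPertH ⇐ (D1) ∧ (D4) ∧ CAP+tail; G-an2-4 gates asym, D1 and NE2/3/4.  PLACEMENT
(human rule 2026-08-19): cell work under `Summits/QuantumFields/BalabanUV/`; imports the tree module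
`T4AveragingDeficitWallBoundary` (`IsPeriodicCfg`, `periodBox`, `mem_periodBox`) only; moves nothing.
-/

set_option autoImplicit false

open scoped BigOperators

namespace Summit.QuantumFields.BalabanUV.T4Continuum.PeriodicChoice

open Literature.MathematicalPhysics.QuantumFieldTheory.Balaban1983to89
open B7Prop1Explicit (Site e e_apply sum_zsmul_e)
open T4AveragingDeficitWallBoundary (IsPeriodicCfg periodBox mem_periodBox smul_eq_sum_e)

noncomputable section

variable {d : ℕ}

/-! ## §1 Single-direction periodicity extends to all period vectors (any codomain) -/

/-- Single-direction periodicity extends to all integer multiples of the period (any codomain; the tree's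
`periodic_zmul` is the real-valued case). [folklore] -/
theorem periodic_zmul {β : Sort*} {g : Site d → β} {N : ℤ} (hg : ∀ (x : Site d) (κ : Fin d), g (x + N • e κ) = g x)
    (x : Site d) (κ : Fin d) (m : ℤ) : g (x + (m * N) • e κ) = g x := by
  induction m using Int.induction_on generalizing x with
  | zero => simp
  | succ m ih => rw [add_mul, one_mul, add_smul, ← add_assoc, hg, ih]
  | pred m ih =>
      have h1 := hg (x + ((-(m : ℤ) - 1) * N) • e κ) κ
      rw [add_assoc, ← add_smul, show (-(m : ℤ) - 1) * N + N = -(m : ℤ) * N by ring] at h1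
      rw [← h1, ih]

/-- … and to all period vectors: `g(x + N·k) = g(x)` for every `k ∈ ℤ^d` (any codomain). [folklore] -/
theorem periodic_vec {β : Sort*} {g : Site d → β} {N : ℤ} (hg : ∀ (x : Site d) (κ : Fin d), g (x + N • e κ) = g x)
    (x k : Site d) : g (x + N • k) = g x := by
  have key : ∀ (s : Finset (Fin d)) (x : Site d), g (x + ∑ κ ∈ s, (k κ * N) • e κ) = g x := by
    intro s
    induction s using Finset.induction_on with
    | empty => intro x; simp
    | insert κ s hκ ih =>
        intro x
        rw [Finset.sum_insert hκ, ← add_assoc, ih, periodic_zmul hg]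
  rw [smul_eq_sum_e]
  exact key Finset.univ x

/-! ## §2 The wrap map `x ↦ x mod P` (written as the explicit lambda `fun κ => x κ % P`; no definition is introduced) -/

/-- `x = (x mod P) + P • (x div P)`. [folklore] -/
theorem wrap_add_smul_ediv (P : ℕ) (x : Site d) :
    (fun κ => x κ % (P : ℤ)) + (P : ℤ) • (fun κ => x κ / (P : ℤ)) = x := by
  funext κ
  simp only [Pi.add_apply, Pi.smul_apply, smul_eq_mul]
  exact Int.emod_add_mul_ediv (x κ) P

/-- The wrapped representative lies in the period box `[0, P)^d` (`P ≥ 1`). [folklore] -/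
theorem wrap_mem_periodBox (P : ℕ) (hP : 1 ≤ P) (x : Site d) :
    (fun κ => x κ % (P : ℤ)) ∈ periodBox (d := d) P := by
  have hP0 : (0 : ℤ) < P := by exact_mod_cast (by omega : 0 < P)
  exact mem_periodBox.mpr fun κ => ⟨Int.emod_nonneg _ hP0.ne', Int.emod_lt_of_pos _ hP0⟩

/-- Wrapping is invariant under a period shift in one direction. [folklore] -/
theorem wrap_add_smul_e (P : ℕ) (x : Site d) (κ : Fin d) :
    (fun ι => (x + (P : ℤ) • e κ) ι % (P : ℤ)) = fun ι => x ι % (P : ℤ) := by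
  funext ι
  simp only [Pi.add_apply, Pi.smul_apply, smul_eq_mul, e_apply]
  split_ifs
  · rw [mul_one, Int.add_emod_right]
  · rw [mul_zero, add_zero]

/-- A `P`-periodic function (any codomain) factors through the wrap map: `g (x mod P) = g x`. [folklore] -/
theorem apply_wrap_eq {β : Sort*} {g : Site d → β} {P : ℕ} (hg : ∀ (x : Site d) (κ : Fin d), g (x + (P : ℤ) • e κ) = g x)
    (x : Site d) : g (fun κ => x κ % (P : ℤ)) = g x := by
  conv_rhs => rw [← wrap_add_smul_ediv P x]
  exact (periodic_vec hg (fun κ => x κ % (P : ℤ)) _).symm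

/-! ## §3 Periodic choice -/

/-- **PERIODIC CHOICE**: if the predicate `Q x μ ·` is `P`-periodic in the site `x` (one direction at a time) and has a
witness at every `(x, μ)`, then there is a `P`-PERIODIC witness field (choose at the wrapped representative). [folklore] -/
theorem exists_periodic_choice {ι : Type*} {α : Type*} {Q : Site d → ι → α → Prop} (P : ℕ)
    (hQ : ∀ (x : Site d) (κ : Fin d) (μ : ι) (a : α), Q (x + (P : ℤ) • e κ) μ a ↔ Q x μ a)
    (hex : ∀ (x : Site d) (μ : ι), ∃ a, Q x μ a) :
    ∃ c : Site d → ι → α, (∀ (x : Site d) (κ : Fin d) (μ : ι), c (x + (P : ℤ) • e κ) μ = c x μ) ∧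
      ∀ (x : Site d) (μ : ι), Q x μ (c x μ) := by
  classical
  let wr : Site d → Site d := fun x κ => x κ % (P : ℤ)
  have hwr : ∀ (x : Site d) (κ : Fin d), wr (x + (P : ℤ) • e κ) = wr x := fun x κ => wrap_add_smul_e P x κ
  refine ⟨fun x μ => Classical.choose (hex (wr x) μ), fun x κ μ => by simp only [hwr], fun x μ => ?_⟩
  have hw : Q (wr x) μ (Classical.choose (hex (wr x) μ)) := Classical.choose_spec (hex (wr x) μ)
  have hper : ∀ (y : Site d) (κ : Fin d), (fun y => Q y μ (Classical.choose (hex (wr x) μ))) (y + (P : ℤ) • e κ)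
      = (fun y => Q y μ (Classical.choose (hex (wr x) μ))) y := fun y κ => propext (hQ y κ μ _)
  have := apply_wrap_eq (g := fun y => Q y μ (Classical.choose (hex (wr x) μ))) hper x
  exact this ▸ hw

/-- The same with the witness property ALSO required periodic-compatible data in a box: if in addition every witness
can be taken in a prescribed set `S` (`∀ x μ, ∃ a ∈ S, Q x μ a`), the periodic field takes values in `S`. [folklore] -/
theorem exists_periodic_choice_mem {ι : Type*} {α : Type*} {Q : Site d → ι → α → Prop} {S : Set α} (P : ℕ)
    (hQ : ∀ (x : Site d) (κ : Fin d) (μ : ι) (a : α), Q (x + (P : ℤ) • e κ) μ a ↔ Q x μ a)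
    (hex : ∀ (x : Site d) (μ : ι), ∃ a ∈ S, Q x μ a) :
    ∃ c : Site d → ι → α, (∀ (x : Site d) (κ : Fin d) (μ : ι), c (x + (P : ℤ) • e κ) μ = c x μ) ∧
      ∀ (x : Site d) (μ : ι), c x μ ∈ S ∧ Q x μ (c x μ) := by
  have hQ' : ∀ (x : Site d) (κ : Fin d) (μ : ι) (a : α),
      (a ∈ S ∧ Q (x + (P : ℤ) • e κ) μ a) ↔ (a ∈ S ∧ Q x μ a) := fun x κ μ a => by rw [hQ]
  obtain ⟨c, hc, hcQ⟩ := exists_periodic_choice (Q := fun x μ a => a ∈ S ∧ Q x μ a) P hQ'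
    (fun x μ => by obtain ⟨a, ha, hq⟩ := hex x μ; exact ⟨a, ha, hq⟩)
  exact ⟨c, hc, hcQ⟩

/-! ## §4 The configuration reading -/

section Cfg

variable {n : Type*} [Fintype n] [DecidableEq n]

/-- **PERIODIC CHOICE OF A CORRECTION FIELD**: a bond-wise existence statement `∀ x μ, ∃ a ∈ S, Q x μ a` about units of
`M_N(ℂ)` whose predicate is `P`-periodic in the site has a `P`-periodic witness configuration
(`T4AveragingDeficitWallBoundary.IsPeriodicCfg c P` by name) with values in `S`. [folklore] -/
theorem exists_isPeriodicCfg_choice {Q : Site d → Fin d → (Matrix n n ℂ)ˣ → Prop} {S : Set (Matrix n n ℂ)ˣ} (P : ℕ)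
    (hQ : ∀ (x : Site d) (κ μ : Fin d) (a : (Matrix n n ℂ)ˣ), Q (x + (P : ℤ) • e κ) μ a ↔ Q x μ a)
    (hex : ∀ (x : Site d) (μ : Fin d), ∃ a ∈ S, Q x μ a) :
    ∃ c : Site d → Fin d → (Matrix n n ℂ)ˣ, IsPeriodicCfg c (P : ℤ) ∧ ∀ (x : Site d) (μ : Fin d), c x μ ∈ S ∧ Q x μ (c x μ) :=
  exists_periodic_choice_mem P hQ hex

/-- A `P`-periodic configuration is determined by its values on the period box: `c x = c (x mod P)`. [folklore] -/
theorem IsPeriodicCfg.apply_wrap {c : Site d → Fin d → (Matrix n n ℂ)ˣ} {P : ℕ} (hc : IsPeriodicCfg c (P : ℤ))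
    (x : Site d) (μ : Fin d) : c (fun κ => x κ % (P : ℤ)) μ = c x μ := by
  have := apply_wrap_eq (g := fun y => c y μ) (fun y κ => hc y κ μ) x
  exact this

end Cfg

end

end Summit.QuantumFields.BalabanUV.T4Continuum.PeriodicChoice
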